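import Mathlib
import Literature.Computability.AlgebraicComplexity.StandardFamilies
import Literature.Computability.AlgebraicComplexity.VonZurGathenSingPermHeight

/-!
# Sub-permanents of a diagonal matrix plus a rank-one matrix
(crux `ValuativeGCT.HeadFlip`, stmt-ValiantsHypothesis-15535, line `four-row-count`,
stub `stub_subpermDiagRankOne`)

For the pencil `N = diag(d) + u·1ᵀ`, i.e. `N r c = [r = c]·d_r + u_r` over a commutative ring,
every sub-permanent has a closed form: on a row set `Rw` and a column set `Cl` of the same size,
`per[Rw | Cl](N) = Σ_{T ⊆ Cl ∩ Rw} |Rw ∖ T|! · d^T · u^{Rw ∖ T}`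
(`subperm_diagonal_add_rankOne`): a bijection `f : Cl → Rw` contributes `d^T u^{Rw ∖ T}` exactly
when it is the identity on `T`, and there are `|Rw ∖ T|!` such bijections.  The proof is by
expansion along one row (`VonZurGathen.subperm_insert_row`) and induction on the row set.

Specialised to the minors `∂_{(i,j)} per_n = per[≠ i | ≠ j]` (`VonZurGathen.pderiv_perPoly`)
evaluated at the pencil this is the registered stub `stub_subpermDiagRankOne` of the line
skeleton `Cruxes/HeadFlip/Lines/four_row_count.lean`:
`Per_ii = Σ_{S ⊆ [n]∖{i}} |S|!·u^S·d^{[n]∖{i}∖S}` and, for `i ≠ j`,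
`Per_ij = u_j · Σ_{S ⊆ [n]∖{i,j}} (|S|+1)!·u^S·d^{[n]∖{i,j}∖S}`.

Sources: folklore (permanent of a diagonal plus a rank-one matrix; H. Minc, *Permanents*
(1978), §2.1, row expansion §1.2).
-/
set_option linter.dupNamespace false

namespace Summit.ValiantsHypothesis.ValiantsHypothesis.Theorems.HeadFlip

open MvPolynomial Literature.Computability.AlgebraicComplexity
open scoped BigOperators Matrix

section General

variable {ι : Type*} [DecidableEq ι] {A : Type*} [CommRing A]

/-- Reindexing a sum over the subsets of `R` by complementation `T ↦ R ∖ T`. [folklore] -/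
theorem sum_powerset_sdiff_comm {M : Type*} [AddCommMonoid M] (R : Finset ι)
    (f : Finset ι → Finset ι → M) :
    ∑ T ∈ R.powerset, f T (R \ T) = ∑ S ∈ R.powerset, f (R \ S) S := by
  refine Finset.sum_nbij' (R \ ·) (R \ ·) ?_ ?_ ?_ ?_ ?_
  · intro T _
    exact Finset.mem_powerset.2 Finset.sdiff_subset
  · intro S _
    exact Finset.mem_powerset.2 Finset.sdiff_subset
  · intro T hT
    exact Finset.sdiff_sdiff_eq_self (Finset.mem_powerset.1 hT)
  · intro S hS
    exact Finset.sdiff_sdiff_eq_self (Finset.mem_powerset.1 hS)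
  · intro T hT
    simp only [Finset.sdiff_sdiff_eq_self (Finset.mem_powerset.1 hT)]

/-- Regrouping step in the row expansion of `per[Rw | Cl](diag(d) + u·1ᵀ)`: summing the
closed form of the minors `per[Rw | Cl ∖ c]` over the columns `c ∈ Cl` (`|Cl| = |Rw| + 1`) counts
each `T ⊆ Cl ∩ Rw` exactly `|Cl ∖ T| = |Rw ∖ T| + 1` times, turning `|Rw ∖ T|!` into
`(|Rw ∖ T| + 1)!`. [folklore] -/
theorem sum_sum_powerset_erase_inter (d u : ι → A) (Rw Cl : Finset ι)
    (h : Cl.card = Rw.card + 1) :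
    ∑ c ∈ Cl, ∑ T ∈ (Cl.erase c ∩ Rw).powerset,
        ((Rw \ T).card.factorial : A) * (∏ k ∈ T, d k) * ∏ k ∈ Rw \ T, u k =
      ∑ T ∈ (Cl ∩ Rw).powerset,
        (((Rw \ T).card + 1).factorial : A) * (∏ k ∈ T, d k) * ∏ k ∈ Rw \ T, u k := by
  have hfilter : ∀ c, (Cl.erase c ∩ Rw).powerset =
      ((Cl ∩ Rw).powerset).filter (fun T => c ∉ T) := by
    intro c
    ext T
    simp only [Finset.mem_powerset, Finset.mem_filter, Finset.subset_inter_iff,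
      Finset.subset_erase]
    tauto
  simp_rw [hfilter, Finset.sum_filter]
  rw [Finset.sum_comm]
  refine Finset.sum_congr rfl fun T hT => ?_
  have hTsub : T ⊆ Cl ∩ Rw := Finset.mem_powerset.1 hT
  rw [Finset.sum_ite, Finset.sum_const_zero, add_zero, Finset.sum_const, nsmul_eq_mul]
  have hc : (Cl.filter fun c => c ∉ T).card = (Rw \ T).card + 1 := by
    rw [← Finset.sdiff_eq_filter,
      Finset.card_sdiff_of_subset (hTsub.trans Finset.inter_subset_left),
      Finset.card_sdiff_of_subset (hTsub.trans Finset.inter_subset_right), h]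
    have := Finset.card_le_card (hTsub.trans Finset.inter_subset_right)
    omega
  rw [hc, Nat.factorial_succ]
  push_cast
  ring

variable [Fintype ι]

/-- **Sub-permanents of a diagonal matrix plus a rank-one matrix.**  For
`N r c = [r = c]·d_r + u_r` (`N = diag(d) + u·1ᵀ`) and row/column sets `Rw`, `Cl` of the same
size, `per[Rw | Cl](N) = Σ_{T ⊆ Cl ∩ Rw} |Rw ∖ T|! · (∏_{k ∈ T} d_k) · ∏_{k ∈ Rw ∖ T} u_k`: a
bijection `Cl → Rw` picking the diagonal part exactly on `T` must fix `T` pointwise, contributes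
`d^T u^{Rw ∖ T}`, and there are `|Rw ∖ T|!` of them.  Proved by expansion along one row and
induction on `Rw`. [folklore; H. Minc, *Permanents* (1978), §2.1] -/
theorem subperm_diagonal_add_rankOne (d u : ι → A) (Rw Cl : Finset ι) (h : Cl.card = Rw.card) :
    (Matrix.of fun r c : ι => (if r = c then d r else 0) + u r).subperm (· ∈ Cl) (· ∈ Rw) =
      ∑ T ∈ (Cl ∩ Rw).powerset,
        ((Rw \ T).card.factorial : A) * (∏ k ∈ T, d k) * ∏ k ∈ Rw \ T, u k := by
  induction Rw using Finset.induction_on generalizing Cl with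
  | empty =>
    have hCl : Cl = ∅ := Finset.card_eq_zero.1 (by simpa using h)
    subst hCl
    rw [Matrix.subperm_of_isEmpty _ (fun i => Finset.notMem_empty i)
      (fun j => Finset.notMem_empty j)]
    simp
  | insert x Rw' hx ih =>
    rw [VonZurGathen.subperm_insert_row _ hx Cl]
    have hCl : Cl.card = Rw'.card + 1 := by rw [h, Finset.card_insert_of_notMem hx]
    have hcard : ∀ c ∈ Cl, (Cl.erase c).card = Rw'.card := fun c hc => by
      have := Finset.card_erase_of_mem hc
      omega
    rw [Finset.sum_congr rfl fun c hc => by rw [ih (Cl.erase c) (hcard c hc)]]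
    simp only [Matrix.of_apply, add_mul, Finset.sum_add_distrib, ite_mul, zero_mul,
      Finset.sum_ite_eq]
    rw [← Finset.mul_sum, sum_sum_powerset_erase_inter d u Rw' Cl hCl]
    have hterm : ∀ T ∈ (Cl ∩ Rw').powerset,
        u x * ((((Rw' \ T).card + 1).factorial : A) * (∏ k ∈ T, d k) * ∏ k ∈ Rw' \ T, u k) =
          ((insert x Rw' \ T).card.factorial : A) * (∏ k ∈ T, d k) *
            ∏ k ∈ insert x Rw' \ T, u k := by
      intro T hT
      have hT' : T ⊆ Cl ∩ Rw' := Finset.mem_powerset.1 hT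
      have hxT : x ∉ T := fun h' => hx (Finset.mem_inter.1 (hT' h')).2
      have hx' : x ∉ Rw' \ T := fun h' => hx (Finset.mem_sdiff.1 h').1
      rw [Finset.insert_sdiff_of_notMem _ hxT, Finset.card_insert_of_notMem hx',
        Finset.prod_insert hx']
      ring
    by_cases hxCl : x ∈ Cl
    · have hxI : x ∉ Cl ∩ Rw' := fun h' => hx (Finset.mem_inter.1 h').2
      rw [if_pos hxCl, Finset.inter_insert_of_mem hxCl, Finset.sum_powerset_insert hxI,
        Finset.erase_inter, Finset.erase_eq_of_notMem hxI, add_comm, Finset.mul_sum,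
        Finset.mul_sum]
      congr 1
      · exact Finset.sum_congr rfl hterm
      · refine Finset.sum_congr rfl fun T hT => ?_
        have hT' : T ⊆ Cl ∩ Rw' := Finset.mem_powerset.1 hT
        have hxT : x ∉ T := fun h' => hx (Finset.mem_inter.1 (hT' h')).2
        rw [Finset.insert_sdiff_insert, Finset.sdiff_insert_of_notMem hx,
          Finset.prod_insert hxT]
        ring
    · rw [if_neg hxCl, zero_add, Finset.inter_insert_of_notMem hxCl, Finset.mul_sum]
      exact Finset.sum_congr rfl hterm

end General

/-- **stub_subpermDiagRankOne** (closed form of the permanental minors of `diag(d) + u·1ᵀ`).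
Over a commutative `K`-algebra `A`, the partial derivative `∂_{(i,j)} per_n` — the sub-permanent
deleting row `i` and column `j` (`VonZurGathen.pderiv_perPoly`) — evaluated at the pencil
`N_kl = [k = l]·d_k + u_k` equals `Σ_{S ⊆ [n]∖{i}} |S|!·u^S·d^{[n]∖{i}∖S}` if `i = j`, and
`u_j · Σ_{S ⊆ [n]∖{i,j}} (|S|+1)!·u^S·d^{[n]∖{i,j}∖S}` if `i ≠ j` (from
`subperm_diagonal_add_rankOne` with `Rw = [n]∖{i}`, `Cl = [n]∖{j}`, reindexed by `S = Rw ∖ T`,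
resp. `S = ([n]∖{i,j}) ∖ T`). [folklore; H. Minc, *Permanents* (1978), §2.1] -/
theorem stub_subpermDiagRankOne :
    ∀ {K A : Type} [CommRing K] [CommRing A] [Algebra K A] {n : ℕ} (d u : Fin n → A) (i j : Fin n),
      MvPolynomial.aeval (fun kl : Fin n × Fin n => (if kl.1 = kl.2 then d kl.1 else 0) + u kl.1)
          (MvPolynomial.pderiv (i, j) (perPoly (Fin n) K)) =
        if i = j then
          ∑ S ∈ (Finset.univ.erase i).powerset,
            (S.card.factorial : A) * (∏ k ∈ S, u k) * ∏ k ∈ (Finset.univ.erase i) \ S, d k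
        else
          u j * ∑ S ∈ ((Finset.univ.erase i).erase j).powerset,
            ((S.card + 1).factorial : A) * (∏ k ∈ S, u k) * ∏ k ∈ ((Finset.univ.erase i).erase j) \ S, d k := by
  intro K A _ _ _ n d u i j
  rw [VonZurGathen.pderiv_perPoly, VonZurGathen.aeval_subperm_X,
    Matrix.subperm_congr _ (p' := (· ∈ Finset.univ.erase j)) (q' := (· ∈ Finset.univ.erase i))
      (fun k => by simp) (fun k => by simp)]
  have hN : (Matrix.of fun r c : Fin n =>
      (fun kl : Fin n × Fin n => (if kl.1 = kl.2 then d kl.1 else 0) + u kl.1) (r, c)) =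
      Matrix.of fun r c : Fin n => (if r = c then d r else 0) + u r := rfl
  rw [hN, subperm_diagonal_add_rankOne d u _ _ (by simp [Finset.card_erase_of_mem])]
  by_cases hij : i = j
  · subst hij
    rw [if_pos rfl, Finset.inter_self,
      sum_powerset_sdiff_comm (Finset.univ.erase i) (fun T U =>
        (U.card.factorial : A) * (∏ k ∈ T, d k) * ∏ k ∈ U, u k)]
    refine Finset.sum_congr rfl fun S _ => ?_
    ring
  · have hR : Finset.univ.erase j ∩ Finset.univ.erase i = (Finset.univ.erase i).erase j := by
      ext k
      simp only [Finset.mem_inter, Finset.mem_erase, Finset.mem_univ, and_true]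
    have hIns : Finset.univ.erase i = insert j ((Finset.univ.erase i).erase j) :=
      (Finset.insert_erase (Finset.mem_erase.2 ⟨Ne.symm hij, Finset.mem_univ j⟩)).symm
    rw [if_neg hij, hR, Finset.mul_sum,
      ← sum_powerset_sdiff_comm ((Finset.univ.erase i).erase j) (fun T S =>
        u j * (((S.card + 1).factorial : A) * (∏ k ∈ S, u k) * ∏ k ∈ T, d k))]
    refine Finset.sum_congr rfl fun T hT => ?_
    have hT' : T ⊆ (Finset.univ.erase i).erase j := Finset.mem_powerset.1 hT
    have hjT : j ∉ T := fun h' => by simpa using hT' h'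
    have hj' : j ∉ (Finset.univ.erase i).erase j \ T := fun h' => by simp at h'
    rw [hIns, Finset.insert_sdiff_of_notMem _ hjT, ← hIns, Finset.card_insert_of_notMem hj',
      Finset.prod_insert hj']
    · ring

end Summit.ValiantsHypothesis.ValiantsHypothesis.Theorems.HeadFlip
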